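import Mathlib
import Summits.Ventures.HodgeRepro2.T5TeichmullerLift
import Summits.Ventures.HodgeRepro2.T5RootsOfUnityModMaximal

/-!
# `O_Kv^× = μ_{q−1} × U¹`: the Teichmüller decomposition of the units

Every unit `u` of `O_Kv` is uniquely `ζ · u₁` with `ζ^{q−1} = 1` (the Teichmüller lift of the
residue of `u`, `T5TeichmullerLift`) and `u₁ ≡ 1 (mod 𝔪)` (`exists_rootsOfUnity_mul`,
`rootsOfUnity_inf_higherUnits`: a `(q−1)`-th root of unity `≡ 1 (mod 𝔪)` is `1`, since `q − 1` is a
unit of `O_Kv` — `T5RootsOfUnityModMaximal`, row 89).  This is the decomposition behind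
route/T5-route-2.md's (A3)(c) («a finite abelian group of coprime orders is a direct product») and
(A10) bookkeeping of characters of `O_{F_v}^×` by their restrictions to `μ_{q−1}` and to `U¹`.

Declaration per README §8(d): «uses an L-value-free non-vanishing device: NO».
-/

namespace Summit.Ventures.HodgeRepro2.T5TeichmullerDecomposition

open IsDedekindDomain HeightOneSpectrum IsLocalRing

variable {K : Type*} [Field K] [NumberField K] (v : HeightOneSpectrum (NumberField.RingOfIntegers K))

/-- `q − 1` is a unit of `O_Kv` (its residue is `−1`). -/
theorem isUnit_natCast_card_sub_one :
    IsUnit ((Nat.card (ResidueField (adicCompletionIntegers K v)) - 1 : ℕ) : adicCompletionIntegers K v) := by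
  rw [← residue_ne_zero_iff_isUnit, map_natCast]
  exact T5TeichmullerLift.natCast_card_sub_one_ne_zero v

/-- A `(q−1)`-th root of unity with residue `1` is `1` (row 89). -/
theorem eq_one_of_pow_card_sub_one_eq_one_of_residue_eq_one {ζ : adicCompletionIntegers K v}
    (hζ : ζ ^ (Nat.card (ResidueField (adicCompletionIntegers K v)) - 1) = 1)
    (h1 : residue (adicCompletionIntegers K v) ζ = 1) : ζ = 1 :=
  T5RootsOfUnityModMaximal.eq_one_of_pow_eq_one_of_sub_one_mem
    (by rw [← residue_eq_zero_iff, map_sub, map_one, h1, sub_self]) (isUnit_natCast_card_sub_one v) hζ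

/-- THE DECOMPOSITION: every unit `u` of `O_Kv` is `ζ · u₁` with `ζ^{q−1} = 1` and
`residue u₁ = 1`. -/
theorem exists_rootsOfUnity_mul (u : (adicCompletionIntegers K v)ˣ) :
    ∃ ζ : (adicCompletionIntegers K v)ˣ,
      ζ ∈ rootsOfUnity (Nat.card (ResidueField (adicCompletionIntegers K v)) - 1) (adicCompletionIntegers K v) ∧
      ∃ u₁ : (adicCompletionIntegers K v)ˣ, residue (adicCompletionIntegers K v) (u₁ : adicCompletionIntegers K v) = 1 ∧
        u = ζ * u₁ := by
  obtain ⟨ζ, hζ, hζr⟩ := T5TeichmullerLift.exists_rootsOfUnity_residue_eq v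
    (residue (adicCompletionIntegers K v) (u : adicCompletionIntegers K v))
    ((residue_ne_zero_iff_isUnit _).mpr u.isUnit)
  refine ⟨ζ, hζ, ζ⁻¹ * u, ?_, by rw [← mul_assoc, mul_inv_cancel, one_mul]⟩
  rw [Units.val_mul, map_mul]
  have hζ0 : residue (adicCompletionIntegers K v) (ζ : adicCompletionIntegers K v) ≠ 0 :=
    (residue_ne_zero_iff_isUnit _).mpr ζ.isUnit
  have hinv : residue (adicCompletionIntegers K v) ((ζ⁻¹ : (adicCompletionIntegers K v)ˣ) : adicCompletionIntegers K v) =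
      (residue (adicCompletionIntegers K v) (ζ : adicCompletionIntegers K v))⁻¹ := by
    apply eq_inv_of_mul_eq_one_left
    rw [← map_mul, Units.inv_mul, map_one]
  rw [hinv, hζr, inv_mul_cancel₀ ((residue_ne_zero_iff_isUnit _).mpr u.isUnit)]

/-- UNIQUENESS: the root of unity and the principal unit of the decomposition are determined by `u`. -/
theorem rootsOfUnity_eq_of_mul_eq {ζ ζ' u₁ u₁' : (adicCompletionIntegers K v)ˣ}
    (hζ : ζ ∈ rootsOfUnity (Nat.card (ResidueField (adicCompletionIntegers K v)) - 1) (adicCompletionIntegers K v))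
    (hζ' : ζ' ∈ rootsOfUnity (Nat.card (ResidueField (adicCompletionIntegers K v)) - 1) (adicCompletionIntegers K v))
    (h1 : residue (adicCompletionIntegers K v) (u₁ : adicCompletionIntegers K v) = 1)
    (h1' : residue (adicCompletionIntegers K v) (u₁' : adicCompletionIntegers K v) = 1)
    (h : ζ * u₁ = ζ' * u₁') : ζ = ζ' ∧ u₁ = u₁' := by
  -- `ζ⁻¹ ζ' = u₁ u₁'⁻¹` is a root of unity with residue `1`
  have hmem : ζ⁻¹ * ζ' ∈ rootsOfUnity (Nat.card (ResidueField (adicCompletionIntegers K v)) - 1)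
      (adicCompletionIntegers K v) := Subgroup.mul_mem _ (Subgroup.inv_mem _ hζ) hζ'
  have heq : ζ⁻¹ * ζ' = u₁ * u₁'⁻¹ := by
    rw [inv_mul_eq_iff_eq_mul, ← mul_assoc, h, mul_assoc, mul_inv_cancel, mul_one]
  have hres : residue (adicCompletionIntegers K v) ((ζ⁻¹ * ζ' : (adicCompletionIntegers K v)ˣ) : adicCompletionIntegers K v) = 1 := by
    rw [heq, Units.val_mul, map_mul, h1, one_mul]
    have : residue (adicCompletionIntegers K v) ((u₁'⁻¹ : (adicCompletionIntegers K v)ˣ) : adicCompletionIntegers K v) *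
        residue (adicCompletionIntegers K v) (u₁' : adicCompletionIntegers K v) = 1 := by
      rw [← map_mul, Units.inv_mul, map_one]
    rw [h1', mul_one] at this
    exact this
  have hone : ((ζ⁻¹ * ζ' : (adicCompletionIntegers K v)ˣ) : adicCompletionIntegers K v) = 1 := by
    apply eq_one_of_pow_card_sub_one_eq_one_of_residue_eq_one v _ hres
    rw [← Units.val_pow_eq_pow_val, (mem_rootsOfUnity _ _).mp hmem, Units.val_one]
  have hζζ : ζ⁻¹ * ζ' = 1 := Units.ext hone
  refine ⟨(inv_mul_eq_one.mp hζζ), ?_⟩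
  rw [hζζ] at heq
  exact (mul_inv_eq_one.mp heq.symm)

end Summit.Ventures.HodgeRepro2.T5TeichmullerDecomposition
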